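import Summits.RiemannHypothesis.RiemannHypothesis.Theorems.NymanBeurlingGramAutocorr
import Summits.RiemannHypothesis.RiemannHypothesis.Theorems.NymanBeurlingGramPosDef
import HarnessLib

/-!
# RiemannHypothesis / Nyman–Beurling — the first OFF-DIAGONAL Gram entry `G_{12} = ⟨ρ_1, ρ_2⟩ = ¾(log 2π − γ) − ¼ log 2`,
i.e. the instance `(p,q) = (1,2)` of Vasyunin's formula, RH-FREE and unconditional

Column LI/NB of the RH ladder, rung L-P(P2) «structure of the NB minimiser», PROOF-OF-DATA for cell `pub/rh-li`.
`NymanBeurlingFractSqIntegral.lean` gave the Gram DIAGONAL in the kernel; here the first off-diagonal entry is evaluated by the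
same method (Farey cells, partial sums in pairs, Stirling for `(2R)!` and `R!`), with no appeal to the named fact
`BBLS2003_prop89`:

* `OneTwo.integral_nbI_rho_one_rho_two`: on the cell `I_{n+1}` (`m = n+1`, `q = ⌊m/2⌋`),
  `∫ ρ_1 ρ_2 = 1/2 − (q + m/2) log(1 + 1/m) + q/(m+1)`;
* `OneTwo.sum_range_two_mul`: `Σ_{n<2R} = 2R + 1/2 − H_{2R+1}/2 − H_R/4 − 2R log(2R+1) + ½ log (2R)! + R log 2 + log R!`;
* `OneTwo.tendsto_sum_range_two_mul`: `→ ½ log 2 + ¾ log π − ¾ γ − ½` (Stirling twice, `H_n − log(n+1) → γ` twice);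
* `nbGram0_zero_one`, **`nbGram_zero_one : nbGram 0 1 = ¾ (log 2π − γ) − ¼ log 2`** (`= 0.772209255990873…`; the cell
  sums of the float check agree to the `O(1/M)` truncation);
* `fractAutocorr_one_half`: `A(1/2) = ¾(log 2π − γ) − ¼ log 2`, and `bbls2003_prop89_one_two`: this IS the `(1,2)` instance of
  Vasyunin's formula (`V(1,2) = {1/2}·cot(π/2) = 0`, `V(2,1) = 0`) — one instance of the named fact DISCHARGED.

RH-FREE [rh-li-eng-3]: classical real analysis; nothing here bears on the truth of RH.
-/

noncomputable section

-- D-0017: `Summit.<S>.<S>.…` is the designed namespace of a single-problem summit.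
set_option linter.dupNamespace false

open MeasureTheory Set Finset Filter

namespace Summit.RiemannHypothesis.RiemannHypothesis.Theorems.NbTheory

open Literature.NumberTheory.LFunctions Literature.NumberTheory.LFunctions.BaezDuarteOnlyIf
open GramPosDef

namespace OneTwo

/-! ## The cell integral -/

/-- On the cell `I_{n+1}`: `∫ ρ_1 ρ_2 = 1/2 − (q + m/2)·log(1 + 1/m) + q/(m+1)`, `m = n+1`, `q = ⌊m/2⌋`. -/
lemma integral_nbI_rho_one_rho_two (n : ℕ) :
    ∫ x in nbI n, nbRho 0 x * nbRho 1 x =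
      1 / 2 - ((((n + 1) / 2 : ℕ) : ℝ) + ((n : ℝ) + 1) / 2) * Real.log (1 + 1 / ((n : ℝ) + 1))
        + (((n + 1) / 2 : ℕ) : ℝ) / ((n : ℝ) + 2) := by
  have hab := nbI_endpoints_le n
  set m : ℝ := (n : ℝ) + 1 with hm
  set q : ℝ := (((n + 1) / 2 : ℕ) : ℝ) with hq
  have hm0 : 0 < m := by positivity
  have hcongr : ∫ x in nbI n, nbRho 0 x * nbRho 1 x = ∫ x in nbI n, (x⁻¹ - m) * ((2 * x)⁻¹ - q) := by
    refine setIntegral_congr_fun (measurableSet_nbI n) fun x hx ↦ ?_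
    rw [nbRho_eq_of_mem_nbI 0 hx, nbRho_eq_of_mem_nbI 1 hx]
    simp only [Nat.cast_zero, zero_add, one_mul, Nat.cast_one, Nat.div_one, Nat.cast_add, Nat.cast_one, hm, hq]
    rw [one_div, one_div, show ((1 : ℝ) + 1) * x = 2 * x by ring]
  rw [hcongr]
  unfold nbI
  rw [← intervalIntegral.integral_of_le hab]
  have ha0 : (0 : ℝ) < 1 / ((n : ℝ) + 2) := by positivity
  have hderiv : ∀ x ∈ Set.uIcc (1 / ((n : ℝ) + 2)) (1 / ((n : ℝ) + 1)),
      HasDerivAt (fun y : ℝ ↦ -(2 * y)⁻¹ - (q + m / 2) * Real.log y + m * q * y)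
        ((x⁻¹ - m) * ((2 * x)⁻¹ - q)) x := by
    intro x hx
    rw [Set.uIcc_of_le hab] at hx
    have hx0 : x ≠ 0 := (lt_of_lt_of_le ha0 hx.1).ne'
    have h1 : HasDerivAt (fun y : ℝ ↦ (2 * y)⁻¹) (-(2 * (2 * x) ^ 2)⁻¹ * 2 * 2) x := by
      have := ((hasDerivAt_id' x).const_mul 2).inv (by positivity : (2 : ℝ) * x ≠ 0)
      refine this.congr_deriv ?_
      field_simp
    have h2 : HasDerivAt Real.log x⁻¹ x := Real.hasDerivAt_log hx0
    have h := (h1.neg.sub (h2.const_mul (q + m / 2))).add ((hasDerivAt_id' x).const_mul (m * q))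
    refine h.congr_deriv ?_
    field_simp
    ring
  have hint : IntervalIntegrable (fun x : ℝ ↦ (x⁻¹ - m) * ((2 * x)⁻¹ - q)) volume
      (1 / ((n : ℝ) + 2)) (1 / ((n : ℝ) + 1)) := by
    refine (continuousOn_of_forall_continuousAt fun x hx ↦ ?_).intervalIntegrable
    rw [Set.uIcc_of_le hab] at hx
    have hx0 : x ≠ 0 := (lt_of_lt_of_le ha0 hx.1).ne'
    have h2x : 2 * x ≠ 0 := by positivity
    fun_prop (disch := assumption)
  rw [intervalIntegral.integral_eq_sub_of_hasDerivAt hderiv hint]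
  have hlog : Real.log (1 / ((n : ℝ) + 1)) - Real.log (1 / ((n : ℝ) + 2)) = Real.log (1 + 1 / ((n : ℝ) + 1)) := by
    rw [← Real.log_div (by positivity) (by positivity)]
    congr 1
    field_simp
    ring
  have hlin : -(2 * (1 / ((n : ℝ) + 1)))⁻¹ - (q + m / 2) * Real.log (1 / ((n : ℝ) + 1)) + m * q * (1 / ((n : ℝ) + 1))
      - (-(2 * (1 / ((n : ℝ) + 2)))⁻¹ - (q + m / 2) * Real.log (1 / ((n : ℝ) + 2)) + m * q * (1 / ((n : ℝ) + 2))) =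
      ((2 * (1 / ((n : ℝ) + 2)))⁻¹ - (2 * (1 / ((n : ℝ) + 1)))⁻¹) + m * q * (1 / ((n : ℝ) + 1) - 1 / ((n : ℝ) + 2))
        - (q + m / 2) * (Real.log (1 / ((n : ℝ) + 1)) - Real.log (1 / ((n : ℝ) + 2))) := by ring
  rw [hlin, hlog, hm]
  field_simp
  ring

/-- The cell values summed over the partition give `G⁰_{12}` (as a `HasSum`). -/
lemma hasSum_cells :
    HasSum (fun n : ℕ ↦ ∫ x in nbI n, nbRho 0 x * nbRho 1 x) (nbGram0 0 1) := by
  have hint := integrableOn_nbRho_mul_nbRho_Ioc 0 1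
  unfold nbGram0
  rw [Ioc_eq_iUnion_nbI] at hint ⊢
  exact hasSum_integral_iUnion measurableSet_nbI pairwise_disjoint_nbI hint

/-! ## Partial sums in pairs -/

/-- The term as a function of `n`. -/
lemma term_eq (n : ℕ) :
    (1 / 2 - ((((n + 1) / 2 : ℕ) : ℝ) + ((n : ℝ) + 1) / 2) * Real.log (1 + 1 / ((n : ℝ) + 1))
        + (((n + 1) / 2 : ℕ) : ℝ) / ((n : ℝ) + 2) : ℝ) =
      1 / 2 - ((((n + 1) / 2 : ℕ) : ℝ) + ((n : ℝ) + 1) / 2) * (Real.log ((n : ℝ) + 2) - Real.log ((n : ℝ) + 1))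
        + (((n + 1) / 2 : ℕ) : ℝ) / ((n : ℝ) + 2) := by
  have h : Real.log (1 + 1 / ((n : ℝ) + 1)) = Real.log ((n : ℝ) + 2) - Real.log ((n : ℝ) + 1) := by
    rw [← Real.log_div (by positivity) (by positivity)]
    congr 1
    field_simp
    ring
  rw [h]

/-- `Σ_{n < 2R}` of the cell values in closed form. -/
lemma sum_range_two_mul (R : ℕ) :
    ∑ n ∈ Finset.range (2 * R),
        (1 / 2 - ((((n + 1) / 2 : ℕ) : ℝ) + ((n : ℝ) + 1) / 2) * Real.log (1 + 1 / ((n : ℝ) + 1))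
          + (((n + 1) / 2 : ℕ) : ℝ) / ((n : ℝ) + 2)) =
      2 * R + 1 / 2 - (harmonic (2 * R + 1) : ℝ) / 2 - (harmonic R : ℝ) / 4 - 2 * R * Real.log (2 * (R : ℝ) + 1)
        + Real.log ((2 * R).factorial : ℝ) / 2 + R * Real.log 2 + Real.log (R.factorial : ℝ) := by
  induction R with
  | zero => simp
  | succ R ih =>
    have hsplit : Finset.range (2 * (R + 1)) = Finset.range (2 * R + 1 + 1) := by congr 1
    rw [hsplit, Finset.sum_range_succ, Finset.sum_range_succ, ih]
    have hq1 : (2 * R + 1) / 2 = R := by omega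
    have hq2 : (2 * R + 1 + 1) / 2 = R + 1 := by omega
    simp only [hq1, hq2]
    have hl1 : Real.log (1 + 1 / (((2 * R : ℕ) : ℝ) + 1)) = Real.log (2 * (R : ℝ) + 2) - Real.log (2 * (R : ℝ) + 1) := by
      rw [← Real.log_div (by positivity) (by positivity)]
      congr 1
      push_cast
      field_simp
      ring
    have hl2 : Real.log (1 + 1 / (((2 * R + 1 : ℕ) : ℝ) + 1)) =
        Real.log (2 * (R : ℝ) + 3) - Real.log (2 * (R : ℝ) + 2) := by
      rw [← Real.log_div (by positivity) (by positivity)]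
      congr 1
      push_cast
      field_simp
      ring
    rw [hl1, hl2]
    -- harmonic numbers and factorials at the new indices
    have hH1 : (harmonic (2 * (R + 1) + 1) : ℝ) =
        (harmonic (2 * R + 1) : ℝ) + 1 / (2 * (R : ℝ) + 2) + 1 / (2 * (R : ℝ) + 3) := by
      rw [show 2 * (R + 1) + 1 = (2 * R + 1) + 1 + 1 by ring, harmonic_succ, harmonic_succ]
      push_cast
      ring
    have hH2 : (harmonic (R + 1) : ℝ) = (harmonic R : ℝ) + 1 / ((R : ℝ) + 1) := by
      rw [harmonic_succ]; push_cast; ring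
    have hF1 : Real.log ((2 * (R + 1)).factorial : ℝ) =
        Real.log ((2 * R).factorial : ℝ) + Real.log (2 * (R : ℝ) + 1) + Real.log (2 * (R : ℝ) + 2) := by
      rw [show 2 * (R + 1) = (2 * R + 1) + 1 by ring, Nat.factorial_succ, Nat.factorial_succ]
      push_cast
      rw [Real.log_mul (by positivity) (by positivity), Real.log_mul (by positivity) (by positivity)]
      ring
    have hF2 : Real.log ((R + 1).factorial : ℝ) = Real.log (R.factorial : ℝ) + Real.log ((R : ℝ) + 1) := by
      rw [Nat.factorial_succ]
      push_cast
      rw [Real.log_mul (by positivity) (by positivity)]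
      ring
    have hL2 : Real.log (2 * (R : ℝ) + 2) = Real.log 2 + Real.log ((R : ℝ) + 1) := by
      rw [← Real.log_mul (by norm_num) (by positivity)]
      ring_nf
    have hL3 : Real.log (2 * (((R + 1 : ℕ) : ℝ)) + 1) = Real.log (2 * (R : ℝ) + 3) := by
      congr 1; push_cast; ring
    rw [hH1, hH2, hF1, hF2, hL3]
    push_cast
    rw [hL2]
    field_simp
    ring

/-- For `R ≥ 1`, the same partial sum through Stirling's `log n! = log s_n + ½ log(2n) + n log(n/e)`. -/
lemma sum_range_two_mul_eq_stirling {R : ℕ} (hR : 1 ≤ R) :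
    ∑ n ∈ Finset.range (2 * R),
        (1 / 2 - ((((n + 1) / 2 : ℕ) : ℝ) + ((n : ℝ) + 1) / 2) * Real.log (1 + 1 / ((n : ℝ) + 1))
          + (((n + 1) / 2 : ℕ) : ℝ) / ((n : ℝ) + 2)) =
      1 / 2 + Real.log 2 / 2 - ((harmonic (2 * R + 1) : ℝ) - Real.log (2 * (R : ℝ) + 2)) / 2
        - ((harmonic R : ℝ) - Real.log ((R : ℝ) + 1)) / 4 - 3 / 4 * Real.log (1 + 1 / (R : ℝ))
        - (2 * (R : ℝ)) * Real.log (1 + 1 / (2 * (R : ℝ)))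
        + Real.log (Stirling.stirlingSeq (2 * R)) / 2 + Real.log (Stirling.stirlingSeq R) := by
  have hR0 : (0 : ℝ) < R := by exact_mod_cast hR
  rw [sum_range_two_mul, Stirling.log_stirlingSeq_formula, Stirling.log_stirlingSeq_formula]
  push_cast
  rw [Real.log_div (by positivity) (Real.exp_pos 1).ne', Real.log_div hR0.ne' (Real.exp_pos 1).ne', Real.log_exp,
    Real.log_mul two_ne_zero (by positivity : (2 : ℝ) * R ≠ 0), Real.log_mul two_ne_zero hR0.ne']
  have h1 : Real.log (1 + 1 / (R : ℝ)) = Real.log ((R : ℝ) + 1) - Real.log R := by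
    rw [← Real.log_div (by positivity) hR0.ne']
    congr 1
    field_simp
  have h2 : Real.log (1 + 1 / (2 * (R : ℝ))) = Real.log (2 * (R : ℝ) + 1) - Real.log 2 - Real.log R := by
    rw [show (1 + 1 / (2 * (R : ℝ)) : ℝ) = (2 * (R : ℝ) + 1) / (2 * (R : ℝ)) by field_simp,
      Real.log_div (by positivity) (by positivity), Real.log_mul two_ne_zero hR0.ne']
    ring
  have h3 : Real.log (2 * (R : ℝ) + 2) = Real.log 2 + Real.log ((R : ℝ) + 1) := by
    rw [← Real.log_mul (by norm_num) (by positivity)]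
    ring_nf
  rw [h1, h2, h3]
  ring

/-- The paired partial sums tend to `½ log 2 + ¾ log π − ¾ γ − ½`. -/
lemma tendsto_sum_range_two_mul :
    Tendsto (fun R : ℕ ↦ ∑ n ∈ Finset.range (2 * R),
        (1 / 2 - ((((n + 1) / 2 : ℕ) : ℝ) + ((n : ℝ) + 1) / 2) * Real.log (1 + 1 / ((n : ℝ) + 1))
          + (((n + 1) / 2 : ℕ) : ℝ) / ((n : ℝ) + 2)))
      atTop (nhds (Real.log 2 / 2 + 3 / 4 * Real.log Real.pi - 3 / 4 * Real.eulerMascheroniConstant - 1 / 2)) := by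
  have h2R : Tendsto (fun R : ℕ ↦ 2 * R) atTop atTop :=
    tendsto_atTop_mono (fun R : ℕ ↦ (show R ≤ 2 * R by omega)) tendsto_id
  have hγ1 : Tendsto (fun R : ℕ ↦ (harmonic (2 * R + 1) : ℝ) - Real.log (2 * (R : ℝ) + 2)) atTop
      (nhds Real.eulerMascheroniConstant) := by
    have h := Real.tendsto_harmonic_sub_log_add_one.comp
      (tendsto_atTop_mono (fun R : ℕ ↦ (show R ≤ 2 * R + 1 by omega)) tendsto_id :
        Tendsto (fun R : ℕ ↦ 2 * R + 1) atTop atTop)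
    refine h.congr fun R ↦ ?_
    simp only [Function.comp_apply]
    push_cast
    ring_nf
  have hγ2 : Tendsto (fun R : ℕ ↦ (harmonic R : ℝ) - Real.log ((R : ℝ) + 1)) atTop
      (nhds Real.eulerMascheroniConstant) := Real.tendsto_harmonic_sub_log_add_one
  have hlog : Tendsto (fun R : ℕ ↦ Real.log (1 + 1 / (R : ℝ))) atTop (nhds 0) := by
    have h1 : Tendsto (fun R : ℕ ↦ 1 + 1 / (R : ℝ)) atTop (nhds 1) := by
      simpa using tendsto_const_nhds.add (tendsto_const_div_atTop_nhds_zero_nat (1 : ℝ))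
    have h2 := (Real.continuousAt_log one_ne_zero).tendsto.comp h1
    simpa [Function.comp_def, Real.log_one] using h2
  have hNlog : Tendsto (fun R : ℕ ↦ (2 * (R : ℝ)) * Real.log (1 + 1 / (2 * (R : ℝ)))) atTop (nhds 1) := by
    have h := (Real.tendsto_mul_log_one_add_div_atTop 1).comp
      ((tendsto_natCast_atTop_atTop (R := ℝ)).comp h2R)
    refine h.congr fun R ↦ ?_
    simp only [Function.comp_apply]
    push_cast
    ring_nf
  have hsqrt : Real.log (Real.sqrt Real.pi) = Real.log Real.pi / 2 := Real.log_sqrt Real.pi_pos.le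
  have hst1 : Tendsto (fun R : ℕ ↦ Real.log (Stirling.stirlingSeq (2 * R))) atTop (nhds (Real.log Real.pi / 2)) := by
    rw [← hsqrt]
    exact ((Real.continuousAt_log (Real.sqrt_pos.2 Real.pi_pos).ne').tendsto.comp
      Stirling.tendsto_stirlingSeq_sqrt_pi).comp h2R
  have hst2 : Tendsto (fun R : ℕ ↦ Real.log (Stirling.stirlingSeq R)) atTop (nhds (Real.log Real.pi / 2)) := by
    rw [← hsqrt]
    exact (Real.continuousAt_log (Real.sqrt_pos.2 Real.pi_pos).ne').tendsto.comp Stirling.tendsto_stirlingSeq_sqrt_pi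
  have hlim : Tendsto (fun R : ℕ ↦ 1 / 2 + Real.log 2 / 2 - ((harmonic (2 * R + 1) : ℝ) - Real.log (2 * (R : ℝ) + 2)) / 2
        - ((harmonic R : ℝ) - Real.log ((R : ℝ) + 1)) / 4 - 3 / 4 * Real.log (1 + 1 / (R : ℝ))
        - (2 * (R : ℝ)) * Real.log (1 + 1 / (2 * (R : ℝ)))
        + Real.log (Stirling.stirlingSeq (2 * R)) / 2 + Real.log (Stirling.stirlingSeq R)) atTop
      (nhds (1 / 2 + Real.log 2 / 2 - Real.eulerMascheroniConstant / 2 - Real.eulerMascheroniConstant / 4 - 3 / 4 * 0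
        - 1 + Real.log Real.pi / 2 / 2 + Real.log Real.pi / 2)) :=
    ((((((tendsto_const_nhds.sub (hγ1.div_const 2)).sub (hγ2.div_const 4)).sub (hlog.const_mul _)).sub hNlog).add
      (hst1.div_const 2)).add hst2)
  have hval : 1 / 2 + Real.log 2 / 2 - Real.eulerMascheroniConstant / 2 - Real.eulerMascheroniConstant / 4 - 3 / 4 * 0
        - 1 + Real.log Real.pi / 2 / 2 + Real.log Real.pi / 2 =
      Real.log 2 / 2 + 3 / 4 * Real.log Real.pi - 3 / 4 * Real.eulerMascheroniConstant - 1 / 2 := by ring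
  rw [hval] at hlim
  refine hlim.congr' ?_
  filter_upwards [eventually_ge_atTop 1] with R hR
  exact (sum_range_two_mul_eq_stirling hR).symm

end OneTwo

open OneTwo

/-- **`G⁰_{12} = ∫_{(0,1]} ρ_1 ρ_2 = ½ log 2 + ¾ log π − ¾ γ − ½`** (RH-FREE). -/
theorem nbGram0_zero_one :
    nbGram0 0 1 = Real.log 2 / 2 + 3 / 4 * Real.log Real.pi - 3 / 4 * Real.eulerMascheroniConstant - 1 / 2 := by
  -- partial sums of the cell values tend to `G⁰_{12}` (whole sequence), hence along `2R`
  have h1 : Tendsto (fun R : ℕ ↦ ∑ n ∈ Finset.range (2 * R), ∫ x in nbI n, nbRho 0 x * nbRho 1 x) atTop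
      (nhds (nbGram0 0 1)) :=
    hasSum_cells.tendsto_sum_nat.comp (tendsto_atTop_mono (fun R : ℕ ↦ (show R ≤ 2 * R by omega)) tendsto_id)
  have h2 := tendsto_sum_range_two_mul
  simp_rw [← integral_nbI_rho_one_rho_two] at h2
  exact tendsto_nhds_unique h1 h2

/-- **`G_{12} = ⟨ρ_1, ρ_2⟩_{L²(0,∞)} = ¾ (log 2π − γ) − ¼ log 2`** (RH-FREE; `= 0.772209255990873…`). -/
theorem nbGram_zero_one :
    nbGram 0 1 = 3 / 4 * (Real.log (2 * Real.pi) - Real.eulerMascheroniConstant) - Real.log 2 / 4 := by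
  rw [nbGramSplit, nbGram0_zero_one, Real.log_mul two_ne_zero Real.pi_pos.ne']
  norm_num
  ring

/-- **`A(1/2) = ¾(log 2π − γ) − ¼ log 2`** (RH-FREE): the BBLS autocorrelation at `λ = 1/2`. -/
theorem fractAutocorr_one_half :
    fractAutocorr (1 / 2) = 3 / 4 * (Real.log (2 * Real.pi) - Real.eulerMascheroniConstant) - Real.log 2 / 4 := by
  have h := nbGram_eq_fractAutocorr 0 1
  rw [nbGram_zero_one] at h
  norm_num at h
  linarith

/-- **The instance `(p,q) = (1,2)` of Vasyunin's formula `BBLS2003_prop89`, DISCHARGED (RH-FREE):**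
`A(1/2) = (1 − ½)/2·log ½ + (½ + 1)/2·(log 2π − γ) − (π/4)(V(1,2) + V(2,1))` with `V(1,2) = {1/2} cot(π/2) = 0`,
`V(2,1) = 0`. -/
theorem bbls2003_prop89_one_two :
    fractAutocorr ((1 : ℕ) / (2 : ℕ)) =
      (1 - ((1 : ℕ) : ℝ) / (2 : ℕ)) / 2 * Real.log (((1 : ℕ) : ℝ) / (2 : ℕ))
        + (((1 : ℕ) : ℝ) / (2 : ℕ) + 1) / 2 * (Real.log (2 * Real.pi) - Real.eulerMascheroniConstant)
        - Real.pi / (2 * (2 : ℕ)) * (vasyuninCotSum ((1 : ℕ) : ℤ) 2 + vasyuninCotSum ((2 : ℕ) : ℤ) 1) := by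
  have hcot : Real.cot (Real.pi / 2) = 0 := by
    rw [Real.cot_eq_cos_div_sin, Real.cos_pi_div_two, zero_div]
  have hV12 : vasyuninCotSum ((1 : ℕ) : ℤ) 2 = 0 := by
    rw [vasyuninCotSum, show Finset.Ico 1 2 = {1} by rfl, Finset.sum_singleton]
    push_cast
    rw [one_mul, one_mul, hcot, mul_zero]
  have hV21 : vasyuninCotSum ((2 : ℕ) : ℤ) 1 = 0 := by
    rw [vasyuninCotSum, show Finset.Ico 1 1 = ∅ by rfl, Finset.sum_empty]
  rw [hV12, hV21]
  push_cast
  rw [fractAutocorr_one_half, Real.log_div one_ne_zero two_ne_zero, Real.log_one]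
  ring

end Summit.RiemannHypothesis.RiemannHypothesis.Theorems.NbTheory

end
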